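import Summits.CriticalPhenomena.SAWScalingLimit.Theorems.SAWLoopFugacityFlowAvoidanceLimitGreenRatioDecomposition

/-!
# `stub_ratioOscillation` (BHP) reduced to the uniform discrete boundary Harnack principle for the
# `Ω_δ`-walk at the two marked prime ends
— helper file 1 of stub `stub_ratioOscillation` (S3b-BHP) of line `symplectic-fermion-anchor`
(crux `SAWLoopFugacityFlow.AvoidanceLimit`, stmt-CriticalPhenomena-10649)

Setting (as in the stub): `H = discreteDomainGraph D δ` (the walk on `ℤ²` that picks one of the four
lattice directions with probability `¼` and is KILLED when that edge is not an edge of `Ω_δ` —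
edge-killing), the confined graph `H^c = confinedGraph D D' δ ≤ H`, the common volume
`Λ = meshDomainFinset D δ`, `G_K = greenEntry K Λ` (`K ∈ {H, H^c}`), `F_δ = G_{H^c}/G_H`, the marked
points `a = D.pt 0`, `b = D.pt 1`, ball agreement `D' ∩ B(p, ε) = D ∩ B(p, ε)` at `p = a, b`.

This file isolates the ONE harmonic-analysis input of the stub from the Green's-function
bookkeeping. `stub_ratioOscillation_of_uniformBHP` (registered sub-goal) derives the registered
signature of `stub_ratioOscillation` VERBATIM from the hypothesis

* (UBHP) UNIFORM BOUNDARY HARNACK PRINCIPLE FOR THE `Ω_δ`-WALK AT A MARKED PRIME END, in the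
  tree's vocabulary and in multiplicative, division-free form: for a Dobrushin domain `D`, a marked
  point `p = D.pt i`, a radius `R > 0` and `η > 0` there is `r > 0` such that for all small `δ`, any
  two nonnegative functions `h₁, h₂` on `Λ` that are harmonic for the killed walk at every vertex
  of `Λ` within `R` of `p` — `(P h)(x) = h(x)`, `P = ¼·adjMat H Λ` the substochastic transition
  matrix (harmonicity for `P` encodes the zero boundary values at the killed edges) — satisfy
  `h₁(z) h₂(z') ≤ (1 + η) h₁(z') h₂(z)` for all `z, z' ∈ Λ` within `r` of `p`.

  This is D. Chelkak, Y. Wan, Electron. J. Probab. 26 (2021) no. 54, arXiv:1903.08045, §3.2,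
  Lemma 3.7 + Corollary 3.8 (`max_{u,v ∈ Θ^δ(2^{-q}r)} (H₁(u)/H₂(u))/(H₁(v)/H₂(v)) ≤ (1+k^q)/(1−k^q)`,
  universal `k < 1`, for positive discrete harmonic `H₁, H₂` on a simply connected discrete domain
  `Ω^δ ⊂ δℤ²` with Dirichlet conditions on `∂Ω^δ ∖ ∂Ω^δ_o(b, r)`; resting on D. Chelkak, *Robust
  discrete complex analysis: a toolbox*, Ann. Probab. 44 (2016): Thm. 7.1 (cross-ratio / partition
  function / extremal length, eq. (7.3)), Prop. 6.2 and Cor. 6.3 (discrete ≍ continuous extremal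
  length, duality)) TRANSPORTED to the tree's objects. Two things separate (UBHP) from the printed statement, and
  this file does NOT paper over them — they are exactly what a proof of (UBHP) must supply:
  (1) PRINT IS SITE-KILLED, THE TREE IS EDGE-KILLED: the printed theorems are for (induced)
  simply connected sub-domains of `δℤ²` (walk killed when it steps on a vertex outside `Int Ω^δ`),
  whereas two vertices of `Ω_δ` at distance `δ` need not be joined in `Ω_δ` (a lattice edge whose
  closed segment leaves `closure D` is deleted); Chelkak 2016, §2.2 and §6 formulate the theory for
  general `(V^Ω, E^Ω_int)` but the toolbox "always assume[s] that `(vv') ∈ E^Ω_int` for any two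
  neighboring vertices `v, v' ∈ V^Ω` (one can easily remove this assumption, if necessary)"
  (§2.2, parenthetical) — a remark, not a proof;
  (2) EUCLIDEAN BALLS VERSUS INNER NEIGHBOURHOODS: print measures closeness to the prime end `b`
  in the inner metric of the discrete domain (`Θ^δ(r) = Ω^δ ∖ Ω^δ_o(b, r)`, the part cut off from a
  base point by the separating arc of `∂B(b, r)`), the stub — hence (UBHP) — in Euclidean balls
  around the continuum marked point over ALL of `Λ`; that every point of the largest component
  `Λ` Euclidean-close to `a` is inner-close to the prime end `a`, uniformly in small `δ`, is the
  discrete Carathéodory topology of a JORDAN domain at a boundary point (where "Jordan" is used;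
  cf. Karrila's "close approximation of a degenerate prime end", assumed in Chelkak–Wan §2.2).
  The division-free form makes (UBHP) meaningful without positivity guards: where `h₂` vanishes
  on a whole far-reaching piece the inequality forces `h₁ h₂' = 0`, i.e. it also records that for
  small `δ` only ONE `H`-connected piece of `Λ ∩ B(p, R)` reaching `Λ ∖ B(p, R)` comes within `r`
  of `p` (again the Jordan topology); on pieces not reaching `Λ ∖ B(p, R)` every `P`-harmonic
  nonnegative function vanishes identically (strictly substochastic irreducible kernel).

Given (UBHP), the stub is bookkeeping, all of it proved here:
* `transition_mulVec_greenEntry` — `x ↦ G_K(x, w)` is `P_K`-harmonic at every `x ≠ w`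
  (`(1 − P_K) G_K = 1`, `KilledGreen.isUnit_one_sub_transition`);
* `transition_mulVec_congr` — `P_{H^c}` and `P_H` act alike at a vertex where the two graphs have
  the same edges, which is the case within `R ≤ ε/2` of a marked point for `δ ≤ ε/4`
  (`confinedGraph_adj_iff_of_dist_lt`), so `G_{H^c}(·, w)` is `P_H`-harmonic there too;
* `abs_div_sub_div_le_of_mul_le` — two-sided multiplicative closeness of `A/B, A'/B' ∈ [0, 1]`
  gives additive closeness;
* the chain `(z, y) → (z', y) → (z', y')`: (UBHP) at `a` applied to `(G_H(·,y), G_H(·,y'))` first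
  FORCES `G_H(z', y) > 0` from `G_H(z, y) G_H(z', y') > 0`; then (UBHP) at `a` for
  `(G_{H^c}(·,y), G_H(·,y))` and at `b` for `(G_{H^c}(·,z'), G_H(·,z'))` (symmetry `greenEntry_comm`),
  `η/2` each, with `R = min(ε/2, |a−b|/4)` (the poles stay outside `B(p, R)`) and
  `r = min(r_a, r_b, R)`.

Sources: [ChelkakWan2021] §3.2, Lemma 3.7, Corollary 3.8; [Chelkak2016] §2.2, Prop. 6.2, Cor. 6.3, Thm. 7.1;
G. F. Lawler, *Intersections of Random Walks* (1991) §1.5 [Lawler1991] (harmonicity of the killed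
Green's function off the pole). No definitions; nothing from the literature is asserted here.
-/

noncomputable section

open scoped BigOperators Topology Classical
open Filter Finset
open Literature.Probability.RandomPlanarGeometry Literature.Probability.LatticeModels

namespace Summit.CriticalPhenomena.SAWScalingLimit.Theorems.AvoidanceLimit.Anchor

open KilledGreen

/-! ## Harmonicity of the killed Green's function away from its pole -/

/-- **`x ↦ G_K(x, w)` is harmonic for the killed walk at every `x ≠ w`:**
`(P_K G_K(·, w))(x) = G_K(x, w)`, `P_K = ¼·adjMat K Λ`, i.e. `G_K(x,w) = ¼ Σ_{x' ∼_K x, x' ∈ Λ} G_K(x', w)`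
— the `(x, w)` entry of `(1 − P_K)(1 − P_K)⁻¹ = 1` (`K ≤ ℤ²`, so `1 − P_K` is invertible,
`KilledGreen.isUnit_one_sub_transition`); for `w ∉ Λ` both sides vanish. [cite: Lawler1991, §1.5] -/
theorem transition_mulVec_greenEntry {K : SimpleGraph (Site 2)} (hK : K ≤ zdGraph 2)
    (Λ : Finset (Site 2)) (w : Site 2) (x : Λ) (hx : (x : Site 2) ≠ w) :
    Matrix.mulVec ((4 : ℝ)⁻¹ • adjMat K Λ) (fun x' : Λ => greenEntry K Λ x' w) x =
      greenEntry K Λ x w := by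
  by_cases hw : w ∈ Λ
  · have hU : IsUnit ((1 : Matrix Λ Λ ℝ) - (4 : ℝ)⁻¹ • adjMat K Λ).det :=
      (Matrix.isUnit_iff_isUnit_det _).1 (isUnit_one_sub_transition Λ hK)
    have hG : ∀ x' : Λ, greenEntry K Λ x' w =
        ((1 : Matrix Λ Λ ℝ) - (4 : ℝ)⁻¹ • adjMat K Λ)⁻¹ x' ⟨w, hw⟩ := fun x' => by
      rw [greenEntry, dif_pos ⟨x'.2, hw⟩]
    have key := Matrix.mul_nonsing_inv _ hU
    rw [Matrix.sub_mul, Matrix.one_mul] at key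
    have h := congr_fun (congr_fun key x) ⟨w, hw⟩
    rw [Matrix.sub_apply, Matrix.mul_apply,
      Matrix.one_apply_ne (fun h' => hx (congrArg Subtype.val h'))] at h
    simp only [Matrix.mulVec, dotProduct, hG]
    linarith
  · have h0 : ∀ x' : Λ, greenEntry K Λ x' w = 0 := fun x' => greenEntry_of_not K fun h => hw h.2
    simp only [Matrix.mulVec, dotProduct, h0, mul_zero, Finset.sum_const_zero]

/-- At a vertex where two graphs have the same edges their transition matrices act alike.
[folklore] -/
theorem transition_mulVec_congr {K₁ K₂ : SimpleGraph (Site 2)} {Λ : Finset (Site 2)} (f : Λ → ℝ)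
    {x : Λ} (h : ∀ x' : Λ, K₁.Adj x x' ↔ K₂.Adj x x') :
    Matrix.mulVec ((4 : ℝ)⁻¹ • adjMat K₁ Λ) f x = Matrix.mulVec ((4 : ℝ)⁻¹ • adjMat K₂ Λ) f x := by
  simp only [Matrix.mulVec, dotProduct, transition_apply]
  exact Finset.sum_congr rfl fun x' _ => by rw [if_congr (h x') rfl rfl]

/-- **Multiplicative closeness of two ratios in `[0, 1]` gives additive closeness**: if
`0 ≤ A ≤ B`, `0 ≤ A' ≤ B'`, `B, B' > 0`, `A B' ≤ (1+η) A' B` and `A' B ≤ (1+η) A B'`, then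
`|A/B − A'/B'| ≤ η`. [folklore] -/
theorem abs_div_sub_div_le_of_mul_le {A B A' B' η : ℝ} (hη : 0 ≤ η) (hB : 0 < B) (hB' : 0 < B')
    (hA : 0 ≤ A) (hA' : 0 ≤ A') (hAB : A ≤ B) (hAB' : A' ≤ B')
    (h1 : A * B' ≤ (1 + η) * (A' * B)) (h2 : A' * B ≤ (1 + η) * (A * B')) :
    |A / B - A' / B'| ≤ η := by
  have hF : A / B ≤ 1 := div_le_one_of_le₀ hAB hB.le
  have hF' : A' / B' ≤ 1 := div_le_one_of_le₀ hAB' hB'.le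
  have hF0 : 0 ≤ A / B := div_nonneg hA hB.le
  have hF0' : 0 ≤ A' / B' := div_nonneg hA' hB'.le
  have hBB' : 0 < B * B' := mul_pos hB hB'
  have e1 : A / B ≤ A' / B' + η * (A' / B') := by
    rw [← sub_nonneg]
    have : A' / B' + η * (A' / B') - A / B = ((1 + η) * (A' * B) - A * B') / (B * B') := by
      field_simp
    rw [this]
    exact div_nonneg (by linarith) hBB'.le
  have e2 : A' / B' ≤ A / B + η * (A / B) := by
    rw [← sub_nonneg]
    have : A / B + η * (A / B) - A' / B' = ((1 + η) * (A * B') - A' * B) / (B * B') := by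
      field_simp
    rw [this]
    exact div_nonneg (by linarith) hBB'.le
  have m1 : η * (A' / B') ≤ η := by nlinarith
  have m2 : η * (A / B) ≤ η := by nlinarith
  rw [abs_sub_le_iff]
  constructor <;> linarith

/-! ## The registered reduction -/

/-- **REDUCTION (registered sub-goal): `stub_ratioOscillation` from the uniform discrete boundary
Harnack principle (UBHP) for the `Ω_δ`-walk at the marked prime ends.** The hypothesis: for every
Dobrushin domain `D`, marked point `p = D.pt i`, `R > 0` and `η > 0` there is `r > 0` such that,
for all small `δ > 0`, any two nonnegative functions on `Λ = meshDomainFinset D δ` that are harmonic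
for the killed simple random walk of `Ω_δ` (`P h = h`, `P = ¼·adjMat (discreteDomainGraph D δ) Λ`)
at every vertex within `R` of `p` satisfy `h₁(z) h₂(z') ≤ (1 + η) h₁(z') h₂(z)` at all vertices
`z, z'` within `r` of `p` — Chelkak–Wan's Lemma 3.7 / Corollary 3.8 transported to the tree's
edge-killed walk and to Euclidean balls at a prime end of a Jordan domain (see the module
docstring for the exact printed statement and the two gaps). The conclusion is the registered
signature of `stub_ratioOscillation`, by the Green's-function bookkeeping of this file: the column
functions `G_K(·, w)` are `P_H`-harmonic within `R = min(ε/2, |a − b|/4)` of a marked point for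
both `K = H` and `K = H^c` (ball agreement, `δ ≤ ε/4`, pole `w` near the other marked point),
(UBHP) at `a` first forces `G_H(z', y) > 0`, and the chain `(z,y) → (z',y) → (z',y')` costs `η/2`
twice. [cite: ChelkakWan2021, Lemma 3.7 and Corollary 3.8 (§3.2)] -/
theorem stub_ratioOscillation_of_uniformBHP :
    (∀ (D : DobrushinDomain) (i : Fin 2) (R : ℝ), 0 < R → ∀ η : ℝ, 0 < η → ∃ r : ℝ, 0 < r ∧
      ∀ᶠ δ in 𝓝[>] (0 : ℝ), ∀ h₁ h₂ : ↥(meshDomainFinset D.carrier δ) → ℝ,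
        (∀ x, 0 ≤ h₁ x) → (∀ x, 0 ≤ h₂ x) →
        (∀ x : ↥(meshDomainFinset D.carrier δ), dist (meshPoint δ x) (D.pt i) < R →
          Matrix.mulVec ((4 : ℝ)⁻¹ • adjMat (discreteDomainGraph D.carrier δ)
            (meshDomainFinset D.carrier δ)) h₁ x = h₁ x) →
        (∀ x : ↥(meshDomainFinset D.carrier δ), dist (meshPoint δ x) (D.pt i) < R →
          Matrix.mulVec ((4 : ℝ)⁻¹ • adjMat (discreteDomainGraph D.carrier δ)
            (meshDomainFinset D.carrier δ)) h₂ x = h₂ x) →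
        ∀ z z' : ↥(meshDomainFinset D.carrier δ), dist (meshPoint δ z) (D.pt i) < r →
          dist (meshPoint δ z') (D.pt i) < r → h₁ z * h₂ z' ≤ (1 + η) * (h₁ z' * h₂ z)) →
    ∀ (D D' : DobrushinDomain), D'.carrier ⊆ D.carrier → D'.pt 0 = D.pt 0 → D'.pt 1 = D.pt 1 →
      (∃ ε : ℝ, 0 < ε ∧ D'.carrier ∩ Metric.ball (D.pt 0) ε = D.carrier ∩ Metric.ball (D.pt 0) ε ∧
      D'.carrier ∩ Metric.ball (D.pt 1) ε = D.carrier ∩ Metric.ball (D.pt 1) ε) →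
      ∀ η : ℝ, 0 < η → ∃ r : ℝ, 0 < r ∧ ∀ᶠ δ in 𝓝[>] (0 : ℝ), ∀ z z' y y' : Site 2,
      dist (meshPoint δ z) (D.pt 0) < r → dist (meshPoint δ z') (D.pt 0) < r →
      dist (meshPoint δ y) (D.pt 1) < r → dist (meshPoint δ y') (D.pt 1) < r →
      0 < greenEntry (discreteDomainGraph D.carrier δ) (meshDomainFinset D.carrier δ) z y →
      0 < greenEntry (discreteDomainGraph D.carrier δ) (meshDomainFinset D.carrier δ) z' y' →
      |greenEntry (confinedGraph D.carrier D'.carrier δ) (meshDomainFinset D.carrier δ) z y /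
      greenEntry (discreteDomainGraph D.carrier δ) (meshDomainFinset D.carrier δ) z y -
      greenEntry (confinedGraph D.carrier D'.carrier δ) (meshDomainFinset D.carrier δ) z' y' /
      greenEntry (discreteDomainGraph D.carrier δ) (meshDomainFinset D.carrier δ) z' y'| ≤ η := by
  intro hBHP D D' _hsub _h0 _h1 hball η hη
  obtain ⟨ε, hε, hb0, hb1⟩ := hball
  -- the radii
  have hab : 0 < dist (D.pt 0) (D.pt 1) :=
    dist_pos.2 fun h => absurd (D.pt_injective h) (by decide)
  set R : ℝ := min (ε / 2) (dist (D.pt 0) (D.pt 1) / 4) with hR_def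
  have hR : 0 < R := by positivity
  have hRε : R ≤ ε / 2 := min_le_left _ _
  have hRab : R ≤ dist (D.pt 0) (D.pt 1) / 4 := min_le_right _ _
  obtain ⟨ra, hra, hA⟩ := hBHP D 0 R hR (η / 2) (by positivity)
  obtain ⟨rb, hrb, hB⟩ := hBHP D 1 R hR (η / 2) (by positivity)
  set r : ℝ := min (min ra rb) R with hr_def
  have hr : 0 < r := by positivity
  have hrra : r ≤ ra := (min_le_left _ _).trans (min_le_left _ _)
  have hrrb : r ≤ rb := (min_le_left _ _).trans (min_le_right _ _)
  have hrR : r ≤ R := min_le_right _ _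
  refine ⟨r, hr, ?_⟩
  have hδ : ∀ᶠ δ in 𝓝[>] (0 : ℝ), δ ∈ Set.Ioo (0 : ℝ) (ε / 4) := Ioo_mem_nhdsGT (by positivity)
  filter_upwards [hA, hB, hδ] with δ hA' hB' hδ' z z' y y' hz hz' hy hy' hpos hpos'
  obtain ⟨hδ0, hδε⟩ := hδ'
  -- notation
  set H := discreteDomainGraph D.carrier δ with hH_def
  set Hc := confinedGraph D.carrier D'.carrier δ with hHc_def
  set Λ := meshDomainFinset D.carrier δ with hΛ_def
  have hH : H ≤ zdGraph 2 := (discreteDomainGraph_le_meshGraph _ δ).trans (meshGraph_le_zdGraph _ δ)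
  have hHc : Hc ≤ H := confinedGraph_le _ _ δ
  have hHcz : Hc ≤ zdGraph 2 := hHc.trans hH
  have hε2 : R + 2 * δ ≤ ε := by linarith
  -- the four points lie in the volume
  have hmem : z ∈ Λ ∧ y ∈ Λ := by
    by_contra h
    exact hpos.ne' (greenEntry_of_not H h)
  have hmem' : z' ∈ Λ ∧ y' ∈ Λ := by
    by_contra h
    exact hpos'.ne' (greenEntry_of_not H h)
  -- the poles stay away from the other marked point
  have hfar : ∀ (w : Site 2) (i j : Fin 2), i ≠ j → dist (meshPoint δ w) (D.pt j) < r →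
      ∀ x : Λ, dist (meshPoint δ x) (D.pt i) < R → (x : Site 2) ≠ w := by
    intro w i j hij hw x hx hxw
    have hij' : dist (D.pt i) (D.pt j) = dist (D.pt 0) (D.pt 1) := by
      fin_cases i <;> fin_cases j
      · exact absurd rfl hij
      · rfl
      · exact dist_comm _ _
      · exact absurd rfl hij
    have h3 := dist_triangle (D.pt i) (meshPoint δ w) (D.pt j)
    rw [hij', dist_comm (D.pt i)] at h3
    rw [hxw] at hx
    linarith
  -- harmonicity of the column Green's functions near a marked point, for `H` and for `H^c`
  have harmH : ∀ (w : Site 2) (i j : Fin 2), i ≠ j → dist (meshPoint δ w) (D.pt j) < r →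
      ∀ x : Λ, dist (meshPoint δ x) (D.pt i) < R →
        Matrix.mulVec ((4 : ℝ)⁻¹ • adjMat H Λ) (fun x' : Λ => greenEntry H Λ x' w) x =
          greenEntry H Λ x w :=
    fun w i j hij hw x hx => transition_mulVec_greenEntry hH Λ w x (hfar w i j hij hw x hx)
  have hballi : ∀ i : Fin 2,
      D'.carrier ∩ Metric.ball (D.pt i) ε = D.carrier ∩ Metric.ball (D.pt i) ε := by
    intro i
    fin_cases i
    · exact hb0
    · exact hb1
  have harmHc : ∀ (w : Site 2) (i j : Fin 2), i ≠ j → dist (meshPoint δ w) (D.pt j) < r →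
      ∀ x : Λ, dist (meshPoint δ x) (D.pt i) < R →
        Matrix.mulVec ((4 : ℝ)⁻¹ • adjMat H Λ) (fun x' : Λ => greenEntry Hc Λ x' w) x =
          greenEntry Hc Λ x w := by
    intro w i j hij hw x hx
    rw [← transition_mulVec_congr (K₁ := Hc) (fun x' : Λ => greenEntry Hc Λ x' w)
      (fun x' => confinedGraph_adj_iff_of_dist_lt hδ0 hε2 (hballi i) hx)]
    exact transition_mulVec_greenEntry hHcz Λ w x (hfar w i j hij hw x hx)
  have h01 : (0 : Fin 2) ≠ 1 := by decide
  have h10 : (1 : Fin 2) ≠ 0 := by decide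
  -- nonnegativity and domination
  have hnnH : ∀ (w : Site 2) (x : Λ), 0 ≤ greenEntry H Λ x w := fun w x => greenEntry_nonneg hH Λ x w
  have hnnHc : ∀ (w : Site 2) (x : Λ), 0 ≤ greenEntry Hc Λ x w :=
    fun w x => greenEntry_nonneg hHcz Λ x w
  -- Step 1: (UBHP) at `a` for `(G_H(·,y), G_H(·,y'))` forces `G_H(z', y) > 0`
  have hzra : dist (meshPoint δ z) (D.pt 0) < ra := lt_of_lt_of_le hz hrra
  have hz'ra : dist (meshPoint δ z') (D.pt 0) < ra := lt_of_lt_of_le hz' hrra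
  have hyrb : dist (meshPoint δ y) (D.pt 1) < rb := lt_of_lt_of_le hy hrrb
  have hy'rb : dist (meshPoint δ y') (D.pt 1) < rb := lt_of_lt_of_le hy' hrrb
  have s1 := hA' (fun x : Λ => greenEntry H Λ x y) (fun x : Λ => greenEntry H Λ x y') (hnnH y)
    (hnnH y') (harmH y 0 1 h01 hy) (harmH y' 0 1 h01 hy') ⟨z, hmem.1⟩ ⟨z', hmem'.1⟩ hzra hz'ra
  have hpos1 : 0 < greenEntry H Λ z' y := by
    have hprod : 0 < greenEntry H Λ z y * greenEntry H Λ z' y' := mul_pos hpos hpos'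
    rcases (greenEntry_nonneg hH Λ z' y).eq_or_lt with h | h
    · simp only [← h, zero_mul, mul_zero] at s1
      exact absurd s1 (not_le.2 hprod)
    · exact h
  -- Step 2: (UBHP) at `a` for `(G_{H^c}(·,y), G_H(·,y))`, at `(z, z')` and at `(z', z)`
  have s2 := hA' (fun x : Λ => greenEntry Hc Λ x y) (fun x : Λ => greenEntry H Λ x y) (hnnHc y)
    (hnnH y) (harmHc y 0 1 h01 hy) (harmH y 0 1 h01 hy) ⟨z, hmem.1⟩ ⟨z', hmem'.1⟩ hzra hz'ra
  have s2' := hA' (fun x : Λ => greenEntry Hc Λ x y) (fun x : Λ => greenEntry H Λ x y) (hnnHc y)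
    (hnnH y) (harmHc y 0 1 h01 hy) (harmH y 0 1 h01 hy) ⟨z', hmem'.1⟩ ⟨z, hmem.1⟩ hz'ra hzra
  have e1 : |greenEntry Hc Λ z y / greenEntry H Λ z y -
      greenEntry Hc Λ z' y / greenEntry H Λ z' y| ≤ η / 2 :=
    abs_div_sub_div_le_of_mul_le (by positivity) hpos hpos1 (greenEntry_nonneg hHcz Λ z y)
      (greenEntry_nonneg hHcz Λ z' y) (greenEntry_confined_le _ _ δ Λ z y)
      (greenEntry_confined_le _ _ δ Λ z' y) s2 s2'
  -- Step 3: (UBHP) at `b` for `(G_{H^c}(·,z'), G_H(·,z'))`, at `(y, y')` and at `(y', y)`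
  have s3 := hB' (fun x : Λ => greenEntry Hc Λ x z') (fun x : Λ => greenEntry H Λ x z') (hnnHc z')
    (hnnH z') (harmHc z' 1 0 h10 hz') (harmH z' 1 0 h10 hz') ⟨y, hmem.2⟩ ⟨y', hmem'.2⟩ hyrb hy'rb
  have s3' := hB' (fun x : Λ => greenEntry Hc Λ x z') (fun x : Λ => greenEntry H Λ x z') (hnnHc z')
    (hnnH z') (harmHc z' 1 0 h10 hz') (harmH z' 1 0 h10 hz') ⟨y', hmem'.2⟩ ⟨y, hmem.2⟩ hy'rb hyrb
  simp only [greenEntry_comm hHcz Λ _ z', greenEntry_comm hH Λ _ z'] at s3 s3'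
  have e2 : |greenEntry Hc Λ z' y / greenEntry H Λ z' y -
      greenEntry Hc Λ z' y' / greenEntry H Λ z' y'| ≤ η / 2 :=
    abs_div_sub_div_le_of_mul_le (by positivity) hpos1 hpos' (greenEntry_nonneg hHcz Λ z' y)
      (greenEntry_nonneg hHcz Λ z' y') (greenEntry_confined_le _ _ δ Λ z' y)
      (greenEntry_confined_le _ _ δ Λ z' y') s3 s3'
  -- conclude
  have t := abs_sub_le (greenEntry Hc Λ z y / greenEntry H Λ z y)
    (greenEntry Hc Λ z' y / greenEntry H Λ z' y) (greenEntry Hc Λ z' y' / greenEntry H Λ z' y')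
  linarith

end Summit.CriticalPhenomena.SAWScalingLimit.Theorems.AvoidanceLimit.Anchor

end
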